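import Mathlib

/-!
# T5MeanValue — Rühl (5-124) at `q₁ = q₂ = k = 3/2`: the lowest-weight matrix coefficient

Kernel form of the computation (N4.3.P2′) of route/T5-N4-p5.md (owner p5): the matrix
element of the positive discrete series `(k, +)` of `SL(2,ℝ)` on its lowest-weight vector
`Φ_k`, read off Rühl's printed formula (Rühl 1970, «The Lorentz group and harmonic analysis»,
§5-10, (5-124), p0127 ll. 24–58):

  `c^{(k,+)}_{q₁q₂}(η) = [(q₁−k)!(k+q₂−1)!/((q₂−k)!(k+q₁−1)!)]^{1/2} (1/2π) ∫₀^{2π} dψ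
      exp{−i(q₁+q₂)ψ} [e^{iψ}cosh(½η) − sinh(½η)]^{−k+q₂} [e^{−iψ}cosh(½η) − sinh(½η)]^{−k−q₂}`.

At `q₁ = q₂ = k = 3/2` the square-root prefactor is `(0!·2!/(0!·2!))^{1/2} = 1`, the first
bracket carries the exponent `−k + q₂ = 0`, the second the exponent `−k − q₂ = −3`, and the
phase is `exp{−3iψ}`. Two facts are kernel-checked here:

1. `ruhl_integrand`: the integrand identity
   `e^{−3iψ}[e^{−iψ}cosh(η/2) − sinh(η/2)]^{−3} = cosh(η/2)^{−3}[1 − e^{iψ}tanh(η/2)]^{−3}`;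
2. `mean_value_inv_cube`: for `0 ≤ t < 1`, `(1/2π)∫₀^{2π}(1 − t e^{iψ})^{−3} dψ = 1`
   (the `ψ`-mean of the binomial series is its constant term; proved from Cauchy's integral
   formula for `z ↦ (1 − z)^{−3}` on the disc of radius `t`, Mathlib `circleIntegral`).

Together (`ruhl_c_kk`): `c^{(3/2,+)}_{3/2,3/2}(η) = cosh(η/2)^{−3}` for `η ≥ 0` — the
absolute value `‖f‖² cosh(η/2)^{−3}` of the forced-vector coefficient used in (N4.3.P1)–(P3).
Mathlib only; nothing about `U(1,1)` or the Weil representation is formalised.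
-/

namespace Summit.Ventures.HodgeRepro2.T5MeanValue

open Complex Real

/-- `tanh x ≥ 0` for `x ≥ 0`. -/
lemma tanh_nonneg_of_nonneg {x : ℝ} (hx : 0 ≤ x) : 0 ≤ Real.tanh x := by
  rw [Real.tanh_eq_sinh_div_cosh]
  exact div_nonneg (Real.sinh_nonneg_iff.mpr hx) (Real.cosh_pos x).le

/-- `1 − e^{iψ} t ≠ 0` for real `t` with `|t| < 1` (here: `t = tanh(η/2)`). -/
lemma one_sub_exp_mul_tanh_ne_zero (η ψ : ℝ) :
    1 - Complex.exp (ψ * I) * (Real.tanh (η / 2) : ℂ) ≠ 0 := by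
  intro h
  have h' : Complex.exp (ψ * I) * (Real.tanh (η / 2) : ℂ) = 1 := by linear_combination -h
  have hn := congrArg norm h'
  rw [norm_mul, Complex.norm_exp_ofReal_mul_I, one_mul, Complex.norm_real, norm_one,
    Real.norm_eq_abs, abs_eq (by norm_num : (0 : ℝ) ≤ 1)] at hn
  have h1 := Real.tanh_lt_one (η / 2)
  have h2 := Real.neg_one_lt_tanh (η / 2)
  rcases hn with hn | hn <;> linarith

/-- **Rühl (5-124), the integrand at `q₁ = q₂ = k = 3/2`.** For real `η, ψ`:
`e^{−3iψ} (e^{−iψ} cosh(η/2) − sinh(η/2))^{−3} = cosh(η/2)^{−3} (1 − e^{iψ} tanh(η/2))^{−3}`. -/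
theorem ruhl_integrand (η ψ : ℝ) :
    Complex.exp (-(3 * ψ * I)) *
        (Complex.exp (-(ψ * I)) * (Real.cosh (η / 2) : ℂ) - (Real.sinh (η / 2) : ℂ)) ^ (-3 : ℤ)
      = (Real.cosh (η / 2) : ℂ) ^ (-3 : ℤ) *
        (1 - Complex.exp (ψ * I) * (Real.tanh (η / 2) : ℂ)) ^ (-3 : ℤ) := by
  have hcpos : 0 < Real.cosh (η / 2) := Real.cosh_pos _
  have hst : Real.sinh (η / 2) = Real.tanh (η / 2) * Real.cosh (η / 2) := by
    rw [Real.tanh_eq_sinh_div_cosh, div_mul_cancel₀ _ hcpos.ne']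
  have hcC : (Real.cosh (η / 2) : ℂ) ≠ 0 := by exact_mod_cast hcpos.ne'
  have hE : Complex.exp (ψ * I) ≠ 0 := Complex.exp_ne_zero _
  have h3 : Complex.exp (-(3 * ψ * I)) = (Complex.exp (ψ * I))⁻¹ ^ 3 := by
    rw [← Complex.exp_neg, ← Complex.exp_nat_mul]
    congr 1
    push_cast
    ring
  have h1 : Complex.exp (-(ψ * I)) = (Complex.exp (ψ * I))⁻¹ := Complex.exp_neg _
  have hne := one_sub_exp_mul_tanh_ne_zero η ψ
  rw [h3, h1, hst]
  push_cast
  simp only [zpow_neg, zpow_ofNat]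
  field_simp

/-- **The mean value of `(1 − t e^{iψ})^{−3}`.** For `0 ≤ t < 1`:
`∫₀^{2π} (1 − t e^{iψ})^{−3} dψ = 2π` (Cauchy's integral formula for `z ↦ (1 − z)^{−3}`
at the centre of the circle `|z| = t`). -/
theorem mean_value_inv_cube (t : ℝ) (ht0 : 0 ≤ t) (ht1 : t < 1) :
    ∫ ψ in (0 : ℝ)..(2 * π), (1 - (t : ℂ) * Complex.exp (ψ * I)) ^ (-3 : ℤ) = 2 * π := by
  rcases eq_or_lt_of_le ht0 with h0 | hpos
  · subst h0
    simp
  · set f : ℂ → ℂ := fun z => (1 - z) ^ (-3 : ℤ) with hf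
    have hne : ∀ z ∈ Metric.closedBall (0 : ℂ) t, 1 - z ≠ 0 := by
      intro z hz h
      have hz1 : z = 1 := by linear_combination -h
      rw [Metric.mem_closedBall, dist_zero_right, hz1, norm_one] at hz
      linarith
    have hcont : ContinuousOn f (Metric.closedBall 0 t) := by
      intro z hz
      apply ContinuousAt.continuousWithinAt
      exact (continuousAt_const.sub continuousAt_id).zpow₀ _ (Or.inl (hne z hz))
    have hdiff : ∀ z ∈ Metric.ball (0 : ℂ) t \ (∅ : Set ℂ), DifferentiableAt ℂ f z := by
      intro z hz
      have hz' : z ∈ Metric.closedBall (0 : ℂ) t := Metric.ball_subset_closedBall hz.1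
      exact ((differentiableAt_const _).sub differentiableAt_id).zpow (Or.inl (hne z hz'))
    have hw : (0 : ℂ) ∈ Metric.ball (0 : ℂ) t := Metric.mem_ball_self hpos
    have key := Complex.circleIntegral_sub_inv_smul_of_differentiable_on_off_countable
      Set.countable_empty hw hcont hdiff
    have hf0 : f 0 = 1 := by simp [hf]
    rw [hf0, smul_eq_mul, mul_one] at key
    rw [circleIntegral] at key
    have hint : ∀ θ : ℝ, deriv (circleMap 0 t) θ • ((circleMap 0 t θ - 0)⁻¹ • f (circleMap 0 t θ))
        = I * (1 - (t : ℂ) * Complex.exp (θ * I)) ^ (-3 : ℤ) := by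
      intro θ
      rw [deriv_circleMap, circleMap_zero, sub_zero, smul_eq_mul, smul_eq_mul, hf]
      have hne' : (t : ℂ) * Complex.exp (θ * I) ≠ 0 :=
        mul_ne_zero (by exact_mod_cast hpos.ne') (Complex.exp_ne_zero _)
      rw [mul_comm _ I, mul_assoc, mul_inv_cancel_left₀ hne']
    simp_rw [hint] at key
    rw [intervalIntegral.integral_const_mul] at key
    have hI : (I : ℂ) ≠ 0 := Complex.I_ne_zero
    have key' : I * (∫ ψ in (0 : ℝ)..(2 * π), (1 - (t : ℂ) * Complex.exp (ψ * I)) ^ (-3 : ℤ))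
        = I * (2 * π) := by
      rw [key]
      ring
    exact mul_left_cancel₀ hI key'

/-- **`c^{(3/2,+)}_{3/2,3/2}(η) = cosh(η/2)^{−3}`.** For `η ≥ 0` (Rühl's (5-2): `η ≥ 0`),
the printed integral (5-124) at `q₁ = q₂ = k = 3/2` (prefactor `1`, exponents `0` and `−3`)
evaluates to `cosh(η/2)^{−3}`. -/
theorem ruhl_c_kk (η : ℝ) (hη : 0 ≤ η) :
    (1 / (2 * π) : ℂ) * ∫ ψ in (0 : ℝ)..(2 * π),
        Complex.exp (-(3 * ψ * I)) *
          (Complex.exp (-(ψ * I)) * (Real.cosh (η / 2) : ℂ) - (Real.sinh (η / 2) : ℂ)) ^ (-3 : ℤ)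
      = (Real.cosh (η / 2) : ℂ) ^ (-3 : ℤ) := by
  simp_rw [ruhl_integrand η]
  rw [intervalIntegral.integral_const_mul]
  have ht0 : 0 ≤ Real.tanh (η / 2) := tanh_nonneg_of_nonneg (by linarith)
  have ht1 : Real.tanh (η / 2) < 1 := Real.tanh_lt_one _
  have hmv := mean_value_inv_cube (Real.tanh (η / 2)) ht0 ht1
  have hcomm : ∀ ψ : ℝ, (1 - Complex.exp (ψ * I) * (Real.tanh (η / 2) : ℂ)) ^ (-3 : ℤ)
      = (1 - (Real.tanh (η / 2) : ℂ) * Complex.exp (ψ * I)) ^ (-3 : ℤ) := by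
    intro ψ
    rw [mul_comm]
  simp_rw [hcomm]
  rw [hmv]
  have hpi : (π : ℂ) ≠ 0 := by exact_mod_cast Real.pi_ne_zero
  field_simp

/-- The same statement with the printed prefactor and the vacuous first bracket made explicit:
`[(0!·2!)/(0!·2!)]^{1/2} = 1` and `[e^{iψ}cosh(η/2) − sinh(η/2)]^{0} = 1`. -/
theorem ruhl_5_124_kk (η : ℝ) (hη : 0 ≤ η) :
    (((((Nat.factorial 0 * Nat.factorial 2 : ℕ) : ℝ) / ((Nat.factorial 0 * Nat.factorial 2 : ℕ) : ℝ))
        ^ ((1 : ℝ) / 2) : ℝ) : ℂ) *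
      ((1 / (2 * π) : ℂ) * ∫ ψ in (0 : ℝ)..(2 * π),
        Complex.exp (-(3 * ψ * I)) *
          (Complex.exp (ψ * I) * (Real.cosh (η / 2) : ℂ) - (Real.sinh (η / 2) : ℂ)) ^ (0 : ℤ) *
          (Complex.exp (-(ψ * I)) * (Real.cosh (η / 2) : ℂ) - (Real.sinh (η / 2) : ℂ)) ^ (-3 : ℤ))
      = (Real.cosh (η / 2) : ℂ) ^ (-3 : ℤ) := by
  have hpre : (((((Nat.factorial 0 * Nat.factorial 2 : ℕ) : ℝ) /
      ((Nat.factorial 0 * Nat.factorial 2 : ℕ) : ℝ)) ^ ((1 : ℝ) / 2) : ℝ) : ℂ) = 1 := by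
    norm_num
  rw [hpre, one_mul]
  simp only [zpow_zero, mul_one]
  exact ruhl_c_kk η hη

end Summit.Ventures.HodgeRepro2.T5MeanValue
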